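import Summits.ResolutionOfSingularities.ResolutionOfSingularities.Theorems.EquisingularLiftEquisingularLiftNatMultiOrdinaryPoints
import Mathlib.RingTheory.Polynomial.GaussLemma
import Mathlib.Algebra.Polynomial.FieldDivision
import Literature.AlgebraicGeometry.Resolution.KollarMaxContactChartsFieldChange
import HarnessLib

/-!
# [OURS · L1 W4.5(b)] EL♮ FOR CAYLEY'S FOUR-NODAL CUBIC SURFACE `x₀x₁x₂ + x₀x₁x₃ + x₀x₂x₃ + x₁x₂x₃ = 0`, EVERY CHARACTERISTIC — first specimen of
# T-MULTIORD `MultiOrd.elNatAt_ordinaryPoints` (crux `Theses.EquisingularLift.EquisingularLiftNat`, stmt-ResolutionOfSingularities-20038)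

NOT a statement of any manuscript; OURS kernel specimen (cell `res-hironaka`, chain w45b; seat res-D-pv-013, own initiative, counted 0). AI-written,
weaker than expert review. No `sorry`, standard axioms. Two definitions (`CayleyCubic.form`, `CayleyCubic.chartEqn`) for readability.

Cayley's cubic surface `F = σ₃(x₀,…,x₃) = 0 ⊂ ℙ³_K` has exactly four singular points, the coordinate vertices, each an ORDINARY DOUBLE POINT, in EVERY
characteristic (including `2` and `3`): all four affine charts `F(x_c := 1)` are the same polynomial `f = σ₂(y) + σ₃(y) = y₀y₁ + y₀y₂ + y₁y₂ + y₀y₁y₂`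
(`F` is symmetric), whose tangent cone `σ₂` is a nonsingular quadric (`σ₂, ∂σ₂ ∈ 𝔭 ⇒ y ⊆ 𝔭`: `y₁y₂ = σ₂ − y₀∂₀σ₂ ∈ 𝔭`, …) and which is singular only at
the origin (`y₁y₂ = f − y₀∂₀f ∈ 𝔭`, then `y_b(1 + y_c) ∈ 𝔭`, …) — both arguments division-free. Hence `MultiOrd.elNatAt_ordinaryPoints` with
`S = [0,1,2,3]` (no chart off the marked vertices is needed): `ELNatAt p K 3 (V₊(F)) ι` — ONE blow-up of `ℙ³_{𝕎(K)}` along the four `𝕎(K)`-points.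

* `CayleyCubic.form`, `chartEqn`, `isHomogeneous_form`, `form_eq`, `dehomogenize_X_of_succAbove_eq`, `dehomogenize_form` (all four charts), `sigma₂_isHomogeneous`,
  `isNonsingularForm_sigma₂`, `sigma₃_mem_pow`, `chartEqn_singular_only_origin`, `not_sigma₂_dvd_sigma₃`, `prime_form`,
  `not_isRegular_cayleyCubic` (the vertices are genuine singular points);
* **`CayleyCubic.elNatAt_cayleyCubic`** — EL♮ for Cayley's nodal cubic surface, every `p`.

References: A. Cayley, *A memoir on cubic surfaces*, Phil. Trans. 159 (1869) (the 4-nodal cubic); Hartshorne I Ex. 5.8; The Stacks Project 080A — through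
the cited tree files.
-/

set_option linter.dupNamespace false -- mandated namespace `Summit.<Summit>.<Problem>` of this single-conjunct summit

noncomputable section

open CategoryTheory AlgebraicGeometry
open MvPolynomial
open Literature.AlgebraicGeometry.Resolution
open Literature.AlgebraicGeometry.Motives Literature.AlgebraicGeometry.Motives.SmoothHypersurface
open Literature.AlgebraicGeometry.Motives.ProjectiveSpace

namespace Summit.ResolutionOfSingularities.ResolutionOfSingularities.Cruxes.EquisingularLiftNat.Sections

namespace CayleyCubic

variable (K : Type) [Field K]

/-! ## The form and its charts -/

/-- The affine chart equation `f = σ₂(y) + σ₃(y) = y₀y₁ + y₀y₂ + y₁y₂ + y₀y₁y₂` (the same for all four charts). [folklore] -/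
def chartEqn : MvPolynomial (Fin 3) K :=
  (X 0 * X 1 + X 0 * X 2 + X 1 * X 2) + X 0 * X 1 * X 2

/-- **Cayley's nodal cubic form** `F = x₀·σ₂(x₁,x₂,x₃) + σ₃(x₁,x₂,x₃) = x₀x₁x₂ + x₀x₁x₃ + x₀x₂x₃ + x₁x₂x₃ ∈ K[x₀,…,x₃]`. [folklore] -/
def form : MvPolynomial (Fin (1 + 2 + 1)) K :=
  X 0 * rename Fin.succ (X 0 * X 1 + X 0 * X 2 + X 1 * X 2 : MvPolynomial (Fin 3) K) + rename Fin.succ (X 0 * X 1 * X 2 : MvPolynomial (Fin 3) K)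

/-- `σ₂ = y₀y₁ + y₀y₂ + y₁y₂` is homogeneous of degree `2`. [folklore] -/
theorem sigma₂_isHomogeneous : (X 0 * X 1 + X 0 * X 2 + X 1 * X 2 : MvPolynomial (Fin 3) K).IsHomogeneous 2 := by
  refine ((?_ : IsHomogeneous _ 2).add ?_).add ?_ <;>
    simpa using (isHomogeneous_X K _).mul (isHomogeneous_X K _)

/-- `σ₃ = y₀y₁y₂` is homogeneous of degree `3`. [folklore] -/
theorem sigma₃_isHomogeneous : (X 0 * X 1 * X 2 : MvPolynomial (Fin 3) K).IsHomogeneous 3 := by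
  simpa using ((isHomogeneous_X K 0).mul (isHomogeneous_X K 1)).mul (isHomogeneous_X K 2)

/-- `F` is homogeneous of degree `3`. [folklore] -/
theorem isHomogeneous_form : (form K).IsHomogeneous 3 := by
  have hq : (rename Fin.succ (X 0 * X 1 + X 0 * X 2 + X 1 * X 2 : MvPolynomial (Fin 3) K) : MvPolynomial (Fin (1 + 2 + 1)) K).IsHomogeneous 2 :=
    (sigma₂_isHomogeneous K).rename_isHomogeneous
  have hc : (rename Fin.succ (X 0 * X 1 * X 2 : MvPolynomial (Fin 3) K) : MvPolynomial (Fin (1 + 2 + 1)) K).IsHomogeneous 3 :=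
    (sigma₃_isHomogeneous K).rename_isHomogeneous
  have h0 : ((X 0 : MvPolynomial (Fin (1 + 2 + 1)) K) *
      rename Fin.succ (X 0 * X 1 + X 0 * X 2 + X 1 * X 2 : MvPolynomial (Fin 3) K)).IsHomogeneous 3 := by
    simpa using (isHomogeneous_X K 0).mul hq
  exact h0.add hc

/-- `F` written out in the variables of `ℙ³`. [folklore] -/
theorem form_eq : form K = X 0 * X 1 * X 2 + X 0 * X 1 * X 3 + X 0 * X 2 * X 3 + X 1 * X 2 * X 3 := by
  simp only [form, map_add, map_mul, rename_X]
  change X 0 * (X (1 : Fin (1 + 2 + 1)) * X 2 + X 1 * X 3 + X 2 * X 3) + X 1 * X 2 * X 3 = _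
  ring

/-- `σ₃ ∈ (y)³`. [folklore] -/
theorem sigma₃_mem_pow : (X 0 * X 1 * X 2 : MvPolynomial (Fin 3) K) ∈ Ideal.span (Set.range (X : Fin 3 → MvPolynomial (Fin 3) K)) ^ (2 + 1) := by
  rw [pow_succ, pow_two]
  exact Ideal.mul_mem_mul (Ideal.mul_mem_mul (Ideal.subset_span ⟨0, rfl⟩) (Ideal.subset_span ⟨1, rfl⟩)) (Ideal.subset_span ⟨2, rfl⟩)

/-- `x_a ↦ y_j` under `x_c := 1` when `a = c.succAbove j`. [folklore] -/
theorem dehomogenize_X_of_succAbove_eq (c : Fin (1 + 2 + 1)) (j : Fin 3) (a : Fin (1 + 2 + 1)) (h : c.succAbove j = a) :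
    dehomogenize K c (X a) = X j := by
  rw [← h]
  exact dehomogenize_X_succAbove K c j

/-- **All four charts are `f`**: `F(x_c := 1) = σ₂(y) + σ₃(y)` for `c = 0, 1, 2, 3` (`F` is a symmetric function of the coordinates). [folklore] -/
theorem dehomogenize_form (c : Fin (1 + 2 + 1)) :
    dehomogenize K c (form K) = (X 0 * X 1 + X 0 * X 2 + X 1 * X 2) + X 0 * X 1 * X 2 := by
  -- `dehomogenize` on `F` from its values on the variables
  have key : ∀ (c : Fin (1 + 2 + 1)) (v0 v1 v2 v3 : MvPolynomial (Fin 3) K),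
      dehomogenize K c (X 0) = v0 → dehomogenize K c (X 1) = v1 → dehomogenize K c (X 2) = v2 → dehomogenize K c (X 3) = v3 →
      dehomogenize K c (form K) = v0 * v1 * v2 + v0 * v1 * v3 + v0 * v2 * v3 + v1 * v2 * v3 := by
    intro c v0 v1 v2 v3 h0 h1 h2 h3
    rw [form_eq]
    simp only [map_add, map_mul, h0, h1, h2, h3]
  -- chart by chart (`x_c ↦ 1`, `x_{c.succAbove j} ↦ y_j`)
  have hc : c = 0 ∨ c = 1 ∨ c = 2 ∨ c = 3 := by fin_cases c <;> simp
  rcases hc with rfl | rfl | rfl | rfl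
  · rw [key 0 _ _ _ _ (dehomogenize_X_self K 0) (dehomogenize_X_of_succAbove_eq K 0 0 1 (by decide))
      (dehomogenize_X_of_succAbove_eq K 0 1 2 (by decide)) (dehomogenize_X_of_succAbove_eq K 0 2 3 (by decide))]
    ring
  · rw [key 1 _ _ _ _ (dehomogenize_X_of_succAbove_eq K 1 0 0 (by decide)) (dehomogenize_X_self K 1)
      (dehomogenize_X_of_succAbove_eq K 1 1 2 (by decide)) (dehomogenize_X_of_succAbove_eq K 1 2 3 (by decide))]
    ring
  · rw [key 2 _ _ _ _ (dehomogenize_X_of_succAbove_eq K 2 0 0 (by decide)) (dehomogenize_X_of_succAbove_eq K 2 1 1 (by decide))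
      (dehomogenize_X_self K 2) (dehomogenize_X_of_succAbove_eq K 2 2 3 (by decide))]
    ring
  · rw [key 3 _ _ _ _ (dehomogenize_X_of_succAbove_eq K 3 0 0 (by decide)) (dehomogenize_X_of_succAbove_eq K 3 1 1 (by decide))
      (dehomogenize_X_of_succAbove_eq K 3 2 2 (by decide)) (dehomogenize_X_self K 3)]
    ring

/-! ## The tangent cone `σ₂` is a nonsingular quadric and `f` is singular only at the origin — division-free -/

/-- `∂₀ σ₂ = y₁ + y₂`. [folklore] -/
theorem pderiv_zero_sigma₂ : pderiv 0 (X 0 * X 1 + X 0 * X 2 + X 1 * X 2 : MvPolynomial (Fin 3) K) = X 1 + X 2 := by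
  simp only [map_add, Derivation.leibniz, pderiv_X_self, pderiv_X_of_ne (show (1 : Fin 3) ≠ 0 by decide),
    pderiv_X_of_ne (show (2 : Fin 3) ≠ 0 by decide), smul_eq_mul]
  ring

/-- `∂₁ σ₂ = y₀ + y₂`. [folklore] -/
theorem pderiv_one_sigma₂ : pderiv 1 (X 0 * X 1 + X 0 * X 2 + X 1 * X 2 : MvPolynomial (Fin 3) K) = X 0 + X 2 := by
  simp only [map_add, Derivation.leibniz, pderiv_X_self, pderiv_X_of_ne (show (0 : Fin 3) ≠ 1 by decide),
    pderiv_X_of_ne (show (2 : Fin 3) ≠ 1 by decide), smul_eq_mul]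
  ring

/-- `∂₂ σ₂ = y₀ + y₁`. [folklore] -/
theorem pderiv_two_sigma₂ : pderiv 2 (X 0 * X 1 + X 0 * X 2 + X 1 * X 2 : MvPolynomial (Fin 3) K) = X 0 + X 1 := by
  simp only [map_add, Derivation.leibniz, pderiv_X_self, pderiv_X_of_ne (show (0 : Fin 3) ≠ 2 by decide),
    pderiv_X_of_ne (show (1 : Fin 3) ≠ 2 by decide), smul_eq_mul]
  ring

/-- **`σ₂ = y₀y₁ + y₀y₂ + y₁y₂` is a NONSINGULAR quadric in every characteristic**: at a prime containing `σ₂` and `∂σ₂ = (y₁+y₂, y₀+y₂, y₀+y₁)`,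
`y₁y₂ = σ₂ − y₀(y₁+y₂)` lies in it, so `y₁` or `y₂` does, and then all three (no division by `2`). [cite: Hartshorne1977, I Ex. 5.8] -/
theorem isNonsingularForm_sigma₂ : IsNonsingularForm K (X 0 * X 1 + X 0 * X 2 + X 1 * X 2 : MvPolynomial (Fin 3) K) := by
  intro 𝔭 h𝔭 hq hd
  have h0 := hd 0
  have h1 := hd 1
  have h2 := hd 2
  rw [pderiv_zero_sigma₂] at h0
  rw [pderiv_one_sigma₂] at h1
  rw [pderiv_two_sigma₂] at h2
  -- `y₁ y₂ ∈ 𝔭`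
  have h12 : (X 1 * X 2 : MvPolynomial (Fin 3) K) ∈ 𝔭 := by
    have h := 𝔭.sub_mem hq (𝔭.mul_mem_left (X 0) h0)
    rwa [show (X 0 * X 1 + X 0 * X 2 + X 1 * X 2 - X 0 * (X 1 + X 2) : MvPolynomial (Fin 3) K) = X 1 * X 2 from by ring] at h
  -- from `y_b ∈ 𝔭` and `y_a + y_b ∈ 𝔭`: `y_a ∈ 𝔭`
  have step : ∀ ya yb : MvPolynomial (Fin 3) K, yb ∈ 𝔭 → ya + yb ∈ 𝔭 → ya ∈ 𝔭 := fun ya yb hyb h => by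
    simpa using 𝔭.sub_mem h hyb
  have hall : (X 0 : MvPolynomial (Fin 3) K) ∈ 𝔭 ∧ (X 1 : MvPolynomial (Fin 3) K) ∈ 𝔭 ∧ (X 2 : MvPolynomial (Fin 3) K) ∈ 𝔭 := by
    rcases h𝔭.mem_or_mem h12 with hy1 | hy2
    · have h0' : (X 2 + X 1 : MvPolynomial (Fin 3) K) ∈ 𝔭 := by
        rwa [show (X 2 + X 1 : MvPolynomial (Fin 3) K) = X 1 + X 2 from by ring]
      exact ⟨step _ _ hy1 h2, hy1, step _ _ hy1 h0'⟩
    · exact ⟨step _ _ hy2 h1, step _ _ hy2 h0, hy2⟩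
  intro i
  fin_cases i
  · exact hall.1
  · exact hall.2.1
  · exact hall.2.2

/-- `∂₀ f = y₁ + y₂ + y₁y₂`. [folklore] -/
theorem pderiv_zero_chartEqn : pderiv 0 ((X 0 * X 1 + X 0 * X 2 + X 1 * X 2) + X 0 * X 1 * X 2 : MvPolynomial (Fin 3) K) =
    X 1 + X 2 + X 1 * X 2 := by
  simp only [map_add, Derivation.leibniz, pderiv_X_self, pderiv_X_of_ne (show (1 : Fin 3) ≠ 0 by decide),
    pderiv_X_of_ne (show (2 : Fin 3) ≠ 0 by decide), smul_eq_mul]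
  ring

/-- `∂₁ f = y₀ + y₂ + y₀y₂`. [folklore] -/
theorem pderiv_one_chartEqn : pderiv 1 ((X 0 * X 1 + X 0 * X 2 + X 1 * X 2) + X 0 * X 1 * X 2 : MvPolynomial (Fin 3) K) =
    X 0 + X 2 + X 0 * X 2 := by
  simp only [map_add, Derivation.leibniz, pderiv_X_self, pderiv_X_of_ne (show (0 : Fin 3) ≠ 1 by decide),
    pderiv_X_of_ne (show (2 : Fin 3) ≠ 1 by decide), smul_eq_mul]
  ring

/-- `∂₂ f = y₀ + y₁ + y₀y₁`. [folklore] -/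
theorem pderiv_two_chartEqn : pderiv 2 ((X 0 * X 1 + X 0 * X 2 + X 1 * X 2) + X 0 * X 1 * X 2 : MvPolynomial (Fin 3) K) =
    X 0 + X 1 + X 0 * X 1 := by
  simp only [map_add, Derivation.leibniz, pderiv_X_self, pderiv_X_of_ne (show (0 : Fin 3) ≠ 2 by decide),
    pderiv_X_of_ne (show (1 : Fin 3) ≠ 2 by decide), smul_eq_mul]
  ring

/-- **`f = σ₂ + σ₃` is singular only at the origin, in every characteristic**: at a prime `𝔭 ∋ f` containing `∂f = (y₁+y₂+y₁y₂, …)`,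
`y₁y₂ = f − y₀∂₀f ∈ 𝔭`, so `y₁ ∈ 𝔭` or `y₂ ∈ 𝔭`; and from `y_b ∈ 𝔭`, `y_a + y_b + y_a y_b ∈ 𝔭` one gets `y_a(1 + y_b) ∈ 𝔭` with `1 + y_b ∉ 𝔭`, i.e. `y_a ∈ 𝔭`
(no division by `2` or `3`). [cite: Hartshorne1977, I Ex. 5.8] -/
theorem chartEqn_singular_only_origin (𝔭 : Ideal (MvPolynomial (Fin 3) K)) (h𝔭 : 𝔭.IsPrime)
    (hf : ((X 0 * X 1 + X 0 * X 2 + X 1 * X 2) + X 0 * X 1 * X 2 : MvPolynomial (Fin 3) K) ∈ 𝔭)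
    (hd : ∀ j, pderiv j ((X 0 * X 1 + X 0 * X 2 + X 1 * X 2) + X 0 * X 1 * X 2 : MvPolynomial (Fin 3) K) ∈ 𝔭) :
    ∀ j, (X j : MvPolynomial (Fin 3) K) ∈ 𝔭 := by
  have h0 := hd 0
  have h1 := hd 1
  have h2 := hd 2
  rw [pderiv_zero_chartEqn] at h0
  rw [pderiv_one_chartEqn] at h1
  rw [pderiv_two_chartEqn] at h2
  -- `y₁ y₂ ∈ 𝔭`
  have h12 : (X 1 * X 2 : MvPolynomial (Fin 3) K) ∈ 𝔭 := by
    have h := 𝔭.sub_mem hf (𝔭.mul_mem_left (X 0) h0)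
    rwa [show ((X 0 * X 1 + X 0 * X 2 + X 1 * X 2) + X 0 * X 1 * X 2 - X 0 * (X 1 + X 2 + X 1 * X 2) : MvPolynomial (Fin 3) K) =
      X 1 * X 2 from by ring] at h
  -- `1 + y ∉ 𝔭` whenever `y ∈ 𝔭`
  have hunit : ∀ y : MvPolynomial (Fin 3) K, y ∈ 𝔭 → 1 + y ∉ 𝔭 := fun y hy h =>
    h𝔭.ne_top ((Ideal.eq_top_iff_one _).mpr (by simpa using 𝔭.sub_mem h hy))
  -- from `y_b ∈ 𝔭` and `y_a + y_b + y_a y_b ∈ 𝔭`: `y_a (1 + y_b) ∈ 𝔭`, so `y_a ∈ 𝔭`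
  have step : ∀ ya yb : MvPolynomial (Fin 3) K, yb ∈ 𝔭 → ya + yb + ya * yb ∈ 𝔭 → ya ∈ 𝔭 := by
    intro ya yb hyb h
    have h' : ya * (1 + yb) ∈ 𝔭 := by
      have := 𝔭.sub_mem h hyb
      rwa [show ya + yb + ya * yb - yb = ya * (1 + yb) from by ring] at this
    exact (h𝔭.mem_or_mem h').resolve_right (hunit yb hyb)
  have hall : (X 0 : MvPolynomial (Fin 3) K) ∈ 𝔭 ∧ (X 1 : MvPolynomial (Fin 3) K) ∈ 𝔭 ∧ (X 2 : MvPolynomial (Fin 3) K) ∈ 𝔭 := by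
    rcases h𝔭.mem_or_mem h12 with hy1 | hy2
    · have hy0 : (X 0 : MvPolynomial (Fin 3) K) ∈ 𝔭 := step (X 0) (X 1) hy1 h2
      have hy2 : (X 2 : MvPolynomial (Fin 3) K) ∈ 𝔭 := step (X 2) (X 1) hy1 (by
        rwa [show (X 2 + X 1 + X 2 * X 1 : MvPolynomial (Fin 3) K) = X 1 + X 2 + X 1 * X 2 from by ring])
      exact ⟨hy0, hy1, hy2⟩
    · have hy0 : (X 0 : MvPolynomial (Fin 3) K) ∈ 𝔭 := step (X 0) (X 2) hy2 h1
      have hy1 : (X 1 : MvPolynomial (Fin 3) K) ∈ 𝔭 := step (X 1) (X 2) hy2 h0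
      exact ⟨hy0, hy1, hy2⟩
  intro j
  fin_cases j
  · exact hall.1
  · exact hall.2.1
  · exact hall.2.2

/-! ## `F` is prime: degree one in `x₀` with coprime coefficients -/

/-- `σ₂ ∤ σ₃`: a prime quadric dividing `y₀y₁y₂` would divide, hence be associated to, a variable `y_i`; but `σ₂ = 1 ≠ 0` at the point `y_i = 0`,
`y_j = 1` (`j ≠ i`). [folklore] -/
theorem not_sigma₂_dvd_sigma₃ : ¬ (X 0 * X 1 + X 0 * X 2 + X 1 * X 2 : MvPolynomial (Fin 3) K) ∣ (X 0 * X 1 * X 2 : MvPolynomial (Fin 3) K) := by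
  intro hdvd
  have hqirr : Irreducible (X 0 * X 1 + X 0 * X 2 + X 1 * X 2 : MvPolynomial (Fin 3) K) :=
    (isNonsingularForm_sigma₂ K).irreducible le_rfl (by norm_num) (sigma₂_isHomogeneous K)
  have hqp : Prime (X 0 * X 1 + X 0 * X 2 + X 1 * X 2 : MvPolynomial (Fin 3) K) := hqirr.prime
  -- `σ₂` divides some variable
  have hX : ∃ i : Fin 3, (X 0 * X 1 + X 0 * X 2 + X 1 * X 2 : MvPolynomial (Fin 3) K) ∣ X i := by
    rcases hqp.dvd_or_dvd hdvd with h01 | h2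
    · rcases hqp.dvd_or_dvd h01 with h0 | h1
      · exact ⟨0, h0⟩
      · exact ⟨1, h1⟩
    · exact ⟨2, h2⟩
  obtain ⟨i, hXi⟩ := hX
  -- so `σ₂` is associated to `y_i`, i.e. `y_i ∣ σ₂`; evaluate at the point `y_i = 0`, other coordinates `1`: `σ₂ = 1` there
  have hass := hqirr.associated_of_dvd (X_prime (i := i) (R := K)).irreducible hXi
  obtain ⟨s, hs⟩ := hass.symm.dvd
  have h := congrArg (MvPolynomial.eval (Function.update (fun _ : Fin 3 => (1 : K)) i 0)) hs
  fin_cases i <;> simp [Function.update] at h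

/-- **`F` is prime.** In `x₀`-adic form `F = σ₂·x₀ + σ₃` (`finSuccEquiv`): a degree-one polynomial over the UFD `K[x₁,x₂,x₃]` whose coefficients are
coprime (`σ₂` irreducible and `σ₂ ∤ σ₃`) is primitive, hence irreducible by Gauss's lemma (irreducible over the fraction field, degree one), hence prime.
[cite: Hartshorne1977, I Ex. 5.8] -/
theorem prime_form : Prime (form K) := by
  set q : MvPolynomial (Fin 3) K := X 0 * X 1 + X 0 * X 2 + X 1 * X 2 with hq
  set cu : MvPolynomial (Fin 3) K := X 0 * X 1 * X 2 with hcu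
  have hq0 : q ≠ 0 := (isNonsingularForm_sigma₂ K).ne_zero
  have hqirr : Irreducible q := (isNonsingularForm_sigma₂ K).irreducible le_rfl (by norm_num) (sigma₂_isHomogeneous K)
  -- `x₀`-adic form
  have hfs : finSuccEquiv K 3 (form K) = Polynomial.C q * Polynomial.X + Polynomial.C cu := by
    rw [form, map_add, map_mul, finSuccEquiv_X_zero]
    have hq' := ConeN.finSuccEquiv_rename_succ K (m := 1) q
    have hc' := ConeN.finSuccEquiv_rename_succ K (m := 1) cu
    rw [hq', hc', mul_comm]
  -- primitive
  have hprim : (Polynomial.C q * Polynomial.X + Polynomial.C cu).IsPrimitive := by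
    intro r hr
    have hrq : r ∣ q := by
      have h := (Polynomial.C_dvd_iff_dvd_coeff r _).mp hr 1
      simpa using h
    have hrc : r ∣ cu := by
      have h := (Polynomial.C_dvd_iff_dvd_coeff r _).mp hr 0
      simpa using h
    obtain ⟨s, hs⟩ := hrq
    rcases hqirr.isUnit_or_isUnit hs with hru | hsu
    · exact hru
    · exfalso
      obtain ⟨u, rfl⟩ := hsu
      have hqr : q ∣ r := ⟨↑u⁻¹, by rw [hs, mul_assoc, Units.mul_inv, mul_one]⟩
      exact not_sigma₂_dvd_sigma₃ K (hqr.trans hrc)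
  -- irreducible over the fraction field (degree one), hence irreducible (Gauss), hence prime
  have hqK : algebraMap (MvPolynomial (Fin 3) K) (FractionRing (MvPolynomial (Fin 3) K)) q ≠ 0 := fun h =>
    hq0 ((IsFractionRing.injective (MvPolynomial (Fin 3) K) (FractionRing (MvPolynomial (Fin 3) K))) (h.trans (map_zero _).symm))
  have hirrK : Irreducible (Polynomial.map (algebraMap (MvPolynomial (Fin 3) K) (FractionRing (MvPolynomial (Fin 3) K)))
      (Polynomial.C q * Polynomial.X + Polynomial.C cu)) := by
    rw [Polynomial.map_add, Polynomial.map_mul, Polynomial.map_C, Polynomial.map_X, Polynomial.map_C]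
    exact Polynomial.irreducible_of_degree_eq_one (Polynomial.degree_linear hqK)
  have hirrP : Irreducible (Polynomial.C q * Polynomial.X + Polynomial.C cu) :=
    Polynomial.IsPrimitive.irreducible_of_irreducible_map_of_injective
      (IsFractionRing.injective (MvPolynomial (Fin 3) K) (FractionRing (MvPolynomial (Fin 3) K))) hprim hirrK
  have hirr : Irreducible (form K) := by
    rw [← MulEquiv.irreducible_iff (finSuccEquiv K 3).toMulEquiv]
    change Irreducible (finSuccEquiv K 3 (form K))
    rw [hfs]
    exact hirrP
  exact hirr.prime

/-! ## The vertices are genuine singular points -/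

attribute [local instance] MvPolynomial.gradedAlgebra ProjBaseChange.algebraBase in
/-- **Cayley's cubic surface is NOT regular** (the specimen is not secretly smooth): at the vertex `[1:0:0:0]` the local ring is `K[y]_{(y)}/(f)` with
`f = σ₂ + σ₃ ∈ (y)²`, and a regular local ring modulo a non-zero element of `𝔪²` is never regular (Matsumura 14.2, tree
`notMem_sq_of_isRegularLocalRing_quotient`); the local ring is reached through the chart `Spec (ChartRing F 0) → H` (open immersion, Mathlib
`Spec.stalkIso`) and `ChartRing F 0 ≅ K[y]/(f)`. [cite: Matsumura1987, Thm. 14.2] -/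
theorem not_isRegular_cayleyCubic : ¬ Scheme.IsRegular (hypersurface (form K)).left := by
  intro hreg
  have hd : 0 < 3 := by norm_num
  have hdeh := dehomogenize_form K 0
  have hrad := OrdPointAt.radical_span_dehomogenize_eq K (form K) 0 (isHomogeneous_form K) (prime_form K) _ _ (sigma₂_isHomogeneous K)
    (by norm_num) (sigma₃_mem_pow K) hdeh
  obtain ⟨θ, -⟩ := HypersurfaceSpecimen.exists_chartQuotEquiv (form K) (isHomogeneous_form K) 0 _ hdeh hrad
  -- the origin `𝔪 = (y)` of the chart, its image `𝔪̄` in `K[y]/(f)` and the corresponding point `w₀` of `Spec (ChartRing F 0)`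
  have hf𝔪2 : ((X 0 * X 1 + X 0 * X 2 + X 1 * X 2) + X 0 * X 1 * X 2 : MvPolynomial (Fin 3) K) ∈
      Ideal.span (Set.range (X : Fin 3 → MvPolynomial (Fin 3) K)) ^ 2 := by
    refine Ideal.add_mem _ ?_ (Ideal.pow_le_pow_right (by norm_num) (sigma₃_mem_pow K))
    rw [pow_two]
    refine Ideal.add_mem _ (Ideal.add_mem _ ?_ ?_) ?_ <;>
      exact Ideal.mul_mem_mul (Ideal.subset_span ⟨_, rfl⟩) (Ideal.subset_span ⟨_, rfl⟩)
  have hf𝔪 : ((X 0 * X 1 + X 0 * X 2 + X 1 * X 2) + X 0 * X 1 * X 2 : MvPolynomial (Fin 3) K) ∈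
      Ideal.span (Set.range (X : Fin 3 → MvPolynomial (Fin 3) K)) := Ideal.pow_le_self two_ne_zero hf𝔪2
  have h𝔪 : (Ideal.span (Set.range (X : Fin 3 → MvPolynomial (Fin 3) K))).IsPrime := by
    have h := MvPolynomial.isDomain_quotient_span_X (R := K) (Set.univ : Set (Fin 3))
    rw [Set.image_univ] at h
    exact (Ideal.Quotient.isDomain_iff_prime _).mp h
  set f : MvPolynomial (Fin 3) K := (X 0 * X 1 + X 0 * X 2 + X 1 * X 2) + X 0 * X 1 * X 2 with hfdef
  set 𝔪bar : Ideal (MvPolynomial (Fin 3) K ⧸ Ideal.span {f}) :=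
    (Ideal.span (Set.range (X : Fin 3 → MvPolynomial (Fin 3) K))).map (Ideal.Quotient.mk (Ideal.span {f})) with h𝔪bar
  haveI h𝔪barp : 𝔪bar.IsPrime :=
    Ideal.map_isPrime_of_surjective Ideal.Quotient.mk_surjective (by
      rw [Ideal.mk_ker]
      exact (Ideal.span_singleton_le_iff_mem _).mpr hf𝔪)
  let w₀ : Spec (CommRingCat.of (ChartRing (form K) 0 (isHomogeneous_form K))) := ⟨𝔪bar.comap θ.toRingHom, Ideal.comap_isPrime _ _⟩
  -- the stalk of `H` at the vertex is regular, hence so is `(ChartRing F 0)_{w₀} ≅ (K[y]/(f))_{𝔪̄}`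
  have h1 : IsRegularLocalRing (Localization.AtPrime w₀.asIdeal) := by
    haveI := hreg ((chart (form K) 0 (isHomogeneous_form K) hd).left w₀)
    haveI := isOpenImmersion_chart_left (form K) 0 (isHomogeneous_form K) hd
    exact IsRegularLocalRing.of_ringEquiv
      ((asIso ((chart (form K) 0 (isHomogeneous_form K) hd).left.stalkMap w₀)) ≪≫ Spec.stalkIso _ w₀).commRingCatIsoToRingEquiv
  have h2 : IsRegularLocalRing (Localization.AtPrime 𝔪bar) :=
    OrdPoint.isRegularLocalRing_localization_of_ringEquiv θ w₀.asIdeal 𝔪bar (fun x => by rw [Ideal.mem_comap]; rfl) h1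
  -- `(K[y]/(f))_{𝔪̄} ≅ K[y]_𝔪/(f)` (localisation commutes with quotients)
  have hQ : 𝔪bar.comap (Ideal.Quotient.mk (Ideal.span {f})) = Ideal.span (Set.range (X : Fin 3 → MvPolynomial (Fin 3) K)) := by
    rw [h𝔪bar, Ideal.comap_map_of_surjective _ Ideal.Quotient.mk_surjective, ← RingHom.ker_eq_comap_bot, Ideal.mk_ker]
    exact sup_eq_left.mpr ((Ideal.span_singleton_le_iff_mem _).mpr hf𝔪)
  have h3 := (Summit.ResolutionOfSingularities.ResolutionOfSingularities.Theorems.isRegularLocalRing_localization_quotient_iff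
    (Ideal.span {f}) (Ideal.span (Set.range (X : Fin 3 → MvPolynomial (Fin 3) K))) 𝔪bar hQ).mp h2
  rw [Ideal.map_span, Set.image_singleton] at h3
  have hf0 : f ≠ 0 := fun h => by simpa [hfdef] using congrArg (MvPolynomial.eval ![(1 : K), 1, 0]) h
  -- contradiction with Matsumura 14.2: `f ∈ 𝔪²`
  have ha : algebraMap (MvPolynomial (Fin 3) K) (Localization.AtPrime (Ideal.span (Set.range (X : Fin 3 → MvPolynomial (Fin 3) K)))) f ∈
      IsLocalRing.maximalIdeal _ := by
    rw [← Localization.AtPrime.map_eq_maximalIdeal]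
    exact Ideal.mem_map_of_mem _ hf𝔪
  have ha0 : algebraMap (MvPolynomial (Fin 3) K) (Localization.AtPrime (Ideal.span (Set.range (X : Fin 3 → MvPolynomial (Fin 3) K)))) f ≠ 0 :=
    fun h => hf0 (IsLocalization.injective (Localization.AtPrime (Ideal.span (Set.range (X : Fin 3 → MvPolynomial (Fin 3) K))))
      (Ideal.primeCompl_le_nonZeroDivisors (Ideal.span (Set.range (X : Fin 3 → MvPolynomial (Fin 3) K)))) (h.trans (map_zero _).symm))
  have ha2 : algebraMap (MvPolynomial (Fin 3) K) (Localization.AtPrime (Ideal.span (Set.range (X : Fin 3 → MvPolynomial (Fin 3) K)))) f ∈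
      IsLocalRing.maximalIdeal _ ^ 2 := by
    rw [← Localization.AtPrime.map_eq_maximalIdeal, ← Ideal.map_pow]
    exact Ideal.mem_map_of_mem _ hf𝔪2
  haveI := h3
  exact Literature.AlgebraicGeometry.Resolution.notMem_sq_of_isRegularLocalRing_quotient ha ha0 ha2

/-! ## EL♮ for Cayley's nodal cubic surface -/

attribute [local instance] MvPolynomial.gradedAlgebra ProjBaseChange.algebraBase in
/-- **EL♮ FOR CAYLEY'S FOUR-NODAL CUBIC SURFACE `x₀x₁x₂ + x₀x₁x₃ + x₀x₂x₃ + x₁x₂x₃ = 0 ⊂ ℙ³_K`, IN EVERY CHARACTERISTIC** (`K` algebraically closed of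
characteristic `p`, including `p = 2, 3`): an instance of `MultiOrd.elNatAt_ordinaryPoints` with `S = [0, 1, 2, 3]` (all four coordinate vertices are
ordinary double points: `Φ = σ₂` nonsingular, `Ψ = σ₃ ∈ (y)³`; every chart is singular only at its origin; no chart is off the marked vertices) — ONE
horizontal E1 step along the four `𝕎(K)`-points resolves. [OURS · L1 W4.5b] [folklore] -/
theorem elNatAt_cayleyCubic (p : ℕ) (hp : p.Prime) (K : Type) [Field K] [CharP K p] [IsAlgClosed K] :
    Theorems.EquisingularLift.ELNatAt p K 3 (hypersurface (form K)).left (hypersurfaceι (form K)).left := by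
  refine MultiOrd.elNatAt_ordinaryPoints p hp K (form K) (isHomogeneous_form K) (prime_form K) [0, 1, 2, 3] (by decide)
    (fun c _ => ⟨2, _, _, by norm_num, sigma₂_isHomogeneous K, isNonsingularForm_sigma₂ K, sigma₃_mem_pow K, dehomogenize_form K c⟩)
    (fun c _ P hP hf hd => ?_) (fun c hc => ?_)
  · rw [dehomogenize_form] at hf hd
    exact chartEqn_singular_only_origin K P hP hf hd
  · exfalso
    apply hc
    fin_cases c <;> simp

end CayleyCubic

end Summit.ResolutionOfSingularities.ResolutionOfSingularities.Cruxes.EquisingularLiftNat.Sections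

end
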